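import Summits.PneNP.PneNP.Theorems.Sd2BlSigningObjs
import Summits.PneNP.PneNP.Theorems.Sd2BlMachineTraceSem
import Summits.PneNP.PneNP.Theorems.SfmBlMachineHatSum
import Summits.PneNP.PneNP.Theorems.SfmBlCylinderHat

/-!
# Sign-degree-2 engine, CLOSER part 2b: the machine's two integers ARE the pipeline's cylinder sums
# (cell pnp-ideate, ROUND-18 item K1'' `SignDeg2Signing.SignDeg2SigningFP`, stage S3)

FRONTIER (range avoidance for sign-degree-≤2 local maps at linear stretch; restricted-model algorithmic
rung); nothing here bears on P vs NP.

Twin of `SfmBlSigningStep` (pure CAND) for the instantiated sign-degree-2 machine (`Sd2BlMachineConsts`: tables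
`F0k/F1k/F2k`, `ℓ = ellK k`, `t = tK k`, `L = gL t`) on the code of a `k`-local instance `I` all of whose tables have
sign-degree `≤ 2`, with the canonical certificate `cK I h := certOfIntCert I le_rfl (fun j => certOf k 2 (I.table j) (h j))`
(= `SignDeg2Signing.canonCert I h` by `rfl`) and prover-1's dictionary over `E = SignDeg2Legs.CLeg (cK I h)` (D1i/D2i/D2c:
`srcI`, `dstI`, `pI`, `plegI`, `V₁G/V₂G`, `mem_rlegs_iff_pI`, `mem_slegs_iff_subtypeI`).  For the machine's extraction
state `st = gExtract ℓ t plegs` and the objects of part 2a (`Sd2BlSigningObjs`: `MpS`, `WS`, `badS`, `meetS`):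
* **`traceSum_sd2_eq`** (M3-SEM via `traceSum_eq_sum_cylinder_gen`, cap `|plegs|·(40N)^(8t)` discharged) and
  **`hatSum_sd2_eq`** (M4-SEM via `sum_spotRecs_eq` per spot + p3's `sum_cylinder_hat_eq`, caps `40N` / `(40N)^(4t+1)`).
-/

set_option linter.dupNamespace false -- `Summit.PneNP.PneNP.…`: summit = sub-problem name (D-0017 single-conjunct layout)

namespace Summit.PneNP.PneNP.Theorems.Sd2BlMachine

open Finset Matrix Literature.Computability.Complexity
open Summit.PneNP.PneNP.Theorems.SfmBlMachine
open Summit.PneNP.PneNP.Theorems.CandCutNorm (boolSign)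
open Summit.PneNP.PneNP.Theorems.SfmBl (IsConnectedPair sum_cylinder_hat_eq sum_part_eq₂ card_part_eq)
open Summit.PneNP.PneNP.Theorems.SignRepCertificate (Cert)
open Summit.PneNP.PneNP.Theorems.SignDeg2Legs (Kind coef CLeg)
open Summit.PneNP.PneNP.Theorems.SignDegCertBridge (certOf certOfIntCert)

variable {k n m : ℕ}
/-! ## Wrappers in the `plegsK` spelling (one definitional unfolding each) -/

/-- The machine's pieced legs have no duplicates. -/
theorem nodup_plegsK (I : LocalMap k n m) : (plegsK I).Nodup := by
  rw [plegsK_eq]; exact nodup_pieceLegsG _ (nodup_rawLegs I (F0k k) (F1k k) (F2k k))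

/-- `|labels| = |rawI|` for the machine's extraction state. -/
theorem length_labels_eq (I : LocalMap k n m) (st : List ℕ × ℕ) (hst : gExtract (ellK k) (tK k) (plegsK I) = st) :
    st.1.length = (rawI I (F0k k) (F1k k) (F2k k)).length := by
  rw [← hst, (gExtract_inv (ellK k) (tK k) (plegsK I)).1, plegsK_eq, length_pieceLegsG]

/-- The machine's remainder leg list lists the certificate legs with `pI = none`. -/
theorem mem_rlegsK_iff (I : LocalMap k n m) (h : ∀ j, SignDegLE 2 (I.table j)) (st : List ℕ × ℕ)
    (hst : gExtract (ellK k) (tK k) (plegsK I) = st) (hlab : ∀ lab ∈ st.1, lab ≤ st.2) (x : PLeg) :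
    x ∈ rlegs (plegsK I) st.1 ↔
      ∃ e : {e : CLeg (cK I h) // pI I (cK I h) (F0k k) (F1k k) (F2k k) (coef_canon_eq_coefF I h) st.1 st.2 hlab e = none},
        plegI I (cK I h) (F0k k) (F1k k) (F2k k) (coef_canon_eq_coefF I h) (gL (tK k)) e.1 = x := by
  have hlen := length_labels_eq I st hst
  rw [plegsK_eq, mem_rlegs_iff_pI I (cK I h) (F0k k) (F1k k) (F2k k) (coef_canon_eq_coefF I h) (gL (tK k)) hlab hlen x]
  exact ⟨fun ⟨e, he, hx⟩ => ⟨⟨e, he⟩, hx⟩, fun ⟨e, hx⟩ => ⟨e.1, e.2, hx⟩⟩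

/-- Alternating-sequence counts on the machine's remainder legs: `≤ |plegs| · L^t`. -/
theorem length_aseqsU_rlegsK_le (I : LocalMap k n m) (labels : List ℕ) (t : ℕ) :
    (aseqsU (rlegs (plegsK I) labels) t).length ≤ (plegsK I).length * gL (tK k) ^ t := by
  rw [plegsK_eq, length_pieceLegsG]
  exact length_aseqsU_sub_le_G (gL_pos _) _ (rlegs_sublist _ _) t

/-- Walk counts on the legs inside a pair, for the machine's spot legs: `≤ N · L^ℓ`. -/
theorem length_walksU_legsIn_slegsK_le (I : LocalMap k n m) (labels : List ℕ) (s : ℕ) (W : Cand) (t : ℕ) :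
    (walksU (legsIn (slegs (plegsK I) labels s) W) t).length ≤ gN (plegsK I) * gL (tK k) ^ t := by
  have hsub : List.Sublist (legsIn (slegs (plegsK I) labels s) W) (plegsK I) :=
    (List.filter_sublist).trans (sublist_slegs _ _ _)
  unfold gN
  rw [plegsK_eq] at hsub ⊢
  exact length_walksU_sub_le_G (gL_pos _) _ hsub t

/-! ## The trace part -/

/-- The output field of a certificate leg's pieced leg. -/
theorem plegI_fst (I : LocalMap k n m) (h : ∀ j, SignDegLE 2 (I.table j)) (e : CLeg (cK I h)) :
    (plegI I (cK I h) (F0k k) (F1k k) (F2k k) (coef_canon_eq_coefF I h) (gL (tK k)) e).1 = e.out.val := by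
  have h1 := plegG_out (gL (tK k)) (rawI I (F0k k) (F1k k) (F2k k))
    (posOf I (cK I h) (F0k k) (F1k k) (F2k k) (coef_canon_eq_coefF I h) e).val
    (posOf I (cK I h) (F0k k) (F1k k) (F2k k) (coef_canon_eq_coefF I h) e).isLt
  rw [getElem_posOf, rawOf_out] at h1
  exact h1

/-- The part-matrix entry of the remainder as a sum over the remainder subtype. -/
theorem MpS_eq_subtype (I : LocalMap k n m) (h : ∀ j, SignDegLE 2 (I.table j)) (st : List ℕ × ℕ)
    (hlab : ∀ lab ∈ st.1, lab ≤ st.2) (T : Fin m → Bool) (cc : Option (Fin st.2))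
    (i : LPieceG (gL (tK k)) (rawI I (F0k k) (F1k k) (F2k k))) (q : RPieceG (gL (tK k)) (rawI I (F0k k) (F1k k) (F2k k))) :
    MpS I h st hlab T cc i q = ∑ e ∈ (univ : Finset {e : CLeg (cK I h) //
        pI I (cK I h) (F0k k) (F1k k) (F2k k) (coef_canon_eq_coefF I h) st.1 st.2 hlab e = cc}).filter
        (fun e => srcI I (cK I h) (F0k k) (F1k k) (F2k k) (coef_canon_eq_coefF I h) (gL (tK k)) e.1 = i ∧
          dstI I (cK I h) (F0k k) (F1k k) (F2k k) (coef_canon_eq_coefF I h) (gL (tK k)) e.1 = q),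
      ((boolSign (T e.1.out) : ℤ) : ℝ) := by
  unfold MpS
  rw [sum_part_eq₂ (pI I (cK I h) (F0k k) (F1k k) (F2k k) (coef_canon_eq_coefF I h) st.1 st.2 hlab) cc
    (fun e => srcI I (cK I h) (F0k k) (F1k k) (F2k k) (coef_canon_eq_coefF I h) (gL (tK k)) e = i)
    (fun e => dstI I (cK I h) (F0k k) (F1k k) (F2k k) (coef_canon_eq_coefF I h) (gL (tK k)) e = q)
    (fun e => ((boolSign (T e.out) : ℤ) : ℝ))]

/-- **M3-SEM for the machine's data.** -/
theorem traceSum_sd2_eq (I : LocalMap k n m) (h : ∀ j, SignDegLE 2 (I.table j)) (hN1 : 1 ≤ gN (plegsK I))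
    (st : List ℕ × ℕ) (hst : gExtract (ellK k) (tK k) (plegsK I) = st)
    (hlab : ∀ lab ∈ st.1, lab ≤ st.2) {kk : ℕ} (hkk : kk ≤ m) (T0 : List Bool) :
    ((traceSum kk T0 (2 ^ (m - kk + 1)) (rlegs (plegsK I) st.1) (gCapA (tK k) (plegsK I)) (gUA (plegsK I)) : ℤ) : ℝ)
      = ∑ T ∈ (univ : Finset (Fin m → Bool)).filter
            (fun T => ∀ i ∈ univ.filter (fun i : Fin m => (i : ℕ) < kk), T i = T0.getD i.val false),
          ((Matrix.fromBlocks 0 (MpS I h st hlab T none) (MpS I h st hlab T none)ᵀ 0) ^ (2 * pQ1' (gN (plegsK I)))).trace := by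
  classical
  have hq1 := pQ1'_eq hN1
  have hq : 2 * pQ1' (gN (plegsK I)) = 2 * ((pQ1' (gN (plegsK I)) - 1) + 1) := by
    have : 1 ≤ pQ1' (gN (plegsK I)) := by rw [hq1]; exact Nat.one_le_two_pow
    omega
  rw [hq]
  refine traceSum_eq_sum_cylinder_gen
    (Λ := {e : CLeg (cK I h) // pI I (cK I h) (F0k k) (F1k k) (F2k k) (coef_canon_eq_coefF I h) st.1 st.2 hlab e = none})
    (srcL := fun e => srcI I (cK I h) (F0k k) (F1k k) (F2k k) (coef_canon_eq_coefF I h) (gL (tK k)) e.1)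
    (dstL := fun e => dstI I (cK I h) (F0k k) (F1k k) (F2k k) (coef_canon_eq_coefF I h) (gL (tK k)) e.1)
    (outL := fun e => e.1.out) (ι₁ := Subtype.val) (ι₂ := Subtype.val)
    (φ := fun e => plegI I (cK I h) (F0k k) (F1k k) (F2k k) (coef_canon_eq_coefF I h) (gL (tK k)) e.1)
    (rl := rlegs (plegsK I) st.1)
    (fun a b hab => Subtype.ext (plegI_injective I (cK I h) (F0k k) (F1k k) (F2k k) (coef_canon_eq_coefF I h) _ hab))
    (nodup_rlegs (nodup_plegsK I) _) (mem_rlegsK_iff I h st hst hlab)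
    (fun _ => rfl) (fun _ => rfl) (fun e => plegI_fst I h e.1)
    Subtype.val_injective Subtype.val_injective (fun T => MpS I h st hlab T none)
    (fun T i q => MpS_eq_subtype I h st hlab T none i q) hkk T0 _ _ _ ?_ ?_
  · unfold gUA; rw [List.length_replicate]; omega
  · intro k' hk'
    unfold gUA at hk'; rw [List.length_replicate] at hk'
    obtain ⟨_, _, hLell, _, _⟩ := g_bounds hN1 (tK k)
    unfold gCapA
    refine (length_aseqsU_rlegsK_le I _ k').trans (Nat.mul_le_mul_left _ ?_)
    calc gL (tK k) ^ k' ≤ gL (tK k) ^ (2 * 2 ^ pJ1 (gN (plegsK I))) := Nat.pow_le_pow_right (gL_pos _) (by rw [hq1] at hk'; omega)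
      _ ≤ (40 * gN (plegsK I)) ^ (8 * tK k) := hLell

/-! ## The hat part -/

/-- ONE SPOT: the machine's list sum over the records of spot `s` is the pipeline's cylinder sum of `ê_s`. -/
theorem spot_hat_eq (I : LocalMap k n m) (h : ∀ j, SignDegLE 2 (I.table j)) (hN1 : 1 ≤ gN (plegsK I))
    (st : List ℕ × ℕ) (hst : gExtract (ellK k) (tK k) (plegsK I) = st)
    (hlab : ∀ lab ∈ st.1, lab ≤ st.2) (kk : ℕ) (T0 : List Bool) (s : Fin st.2) :
    ((((spotRecs (gCapS (plegsK I)) (gCapW (tK k) (plegsK I)) (slegs (plegsK I) st.1 s.val)).map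
        fun rec => rec.2.1 * badCount (gG (ellK k) (tK k)) kk T0 m rec).sum : ℕ) : ℝ)
      = ∑ T ∈ (univ : Finset (Fin m → Bool)).filter
            (fun T => ∀ i ∈ univ.filter (fun i : Fin m => (i : ℕ) < kk), T i = T0.getD i.val false),
          ∑ W ∈ badS I h st hlab s T, meetS I h st hlab s W := by
  classical
  obtain ⟨hQ, hT0, hLell, hL2t0, h2t0⟩ := g_bounds hN1 (tK k)
  have ht0' := pT0'_eq hN1
  have hsides : (V₁G (gL (tK k)) (rawI I (F0k k) (F1k k) (F2k k)) st.1 st.2 hlab s).card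
      + (V₂G (gL (tK k)) (rawI I (F0k k) (F1k k) (F2k k)) st.1 st.2 hlab s).card ≤ pT0 (gN (plegsK I)) := by
    have := card_sides_le_pT0' I st hst hlab s; rwa [ht0'] at this
  have hV₁ := image_srcI_eq_V₁G I h st hlab s
  have hV₂ := image_dstI_eq_V₂G I h st hlab s
  have hxs := mem_slegsK_iff I h st hst hlab s
  have hV1 := (card_V₁G_eq_length_lpieces I h st hst hlab s).symm
  have hV2 := (card_V₂G_eq_length_rpieces I h st hst hlab s).symm
  -- the generic M4-SEM identity for this spot
  have key := sum_spotRecs_eq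
    (E := {e : CLeg (cK I h) // pI I (cK I h) (F0k k) (F1k k) (F2k k) (coef_canon_eq_coefF I h) st.1 st.2 hlab e = some s})
    (ι₁ := Subtype.val) (ι₂ := Subtype.val)
    (srcE := fun e => srcI I (cK I h) (F0k k) (F1k k) (F2k k) (coef_canon_eq_coefF I h) (gL (tK k)) e.1)
    (dstE := fun e => dstI I (cK I h) (F0k k) (F1k k) (F2k k) (coef_canon_eq_coefF I h) (gL (tK k)) e.1)
    (φ := fun e => plegI I (cK I h) (F0k k) (F1k k) (F2k k) (coef_canon_eq_coefF I h) (gL (tK k)) e.1)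
    (xs := slegs (plegsK I) st.1 s.val) (m := m) (fun e => e.1.out) (fun e => plegI_fst I h e.1)
    (fun a b hab => Subtype.ext (plegI_injective I (cK I h) (F0k k) (F1k k) (F2k k) (coef_canon_eq_coefF I h) _ hab))
    (nodup_slegsG (nodup_plegsK I) _ _)
    hxs (fun _ => rfl) (fun _ => rfl)
    Subtype.val_injective Subtype.val_injective (fun a => LPieceG.tag _ _ a) (fun b => RPieceG.tag _ _ b)
    (capS := gCapS (plegsK I)) (capW := gCapW (tK k) (plegsK I)) ?_ ?_ (gG (ellK k) (tK k)) kk T0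
  · rw [key, hV₁, hV₂, Nat.cast_sum]
    have hG : Real.sqrt (34 * ellK k * (2 : ℝ) ^ (2 * tK k) * (2 * tK k : ℕ)) = Real.sqrt ((gG (ellK k) (tK k) : ℕ) : ℝ) := by
      have e : ((gG (ellK k) (tK k) : ℕ) : ℝ) = 34 * ellK k * (2 : ℝ) ^ (2 * tK k) * (2 * tK k : ℕ) := by
        unfold gG; push_cast; ring
      rw [e]
    have hrhs := sum_cylinder_hat_eq
      (fun e : {e : CLeg (cK I h) // pI I (cK I h) (F0k k) (F1k k) (F2k k) (coef_canon_eq_coefF I h) st.1 st.2 hlab e = some s} =>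
        srcI I (cK I h) (F0k k) (F1k k) (F2k k) (coef_canon_eq_coefF I h) (gL (tK k)) e.1)
      (fun e => dstI I (cK I h) (F0k k) (F1k k) (F2k k) (coef_canon_eq_coefF I h) (gL (tK k)) e.1) (fun e => e.1.out)
      (gG (ellK k) (tK k)) (fun T => MpS I h st hlab T (some s)) (fun T i q => MpS_eq_subtype I h st hlab T (some s) i q)
      (WS I h st hlab s) (meetS I h st hlab s)
      ((univ : Finset (Fin m → Bool)).filter
        (fun T => ∀ i ∈ univ.filter (fun i : Fin m => (i : ℕ) < kk), T i = T0.getD i.val false))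
    unfold badS
    rw [hG, hrhs]
    refine Finset.sum_congr rfl fun W _ => ?_
    rw [Nat.cast_mul]
    refine congrArg₂ (· * ·) ?_ (congrArg Nat.cast ?_)
    · unfold meetS
      rw [card_part_eq (pI I (cK I h) (F0k k) (F1k k) (F2k k) (coef_canon_eq_coefF I h) st.1 st.2 hlab) (some s)
        (fun e => srcI I (cK I h) (F0k k) (F1k k) (F2k k) (coef_canon_eq_coefF I h) (gL (tK k)) e ∈ W.1 ∨
          dstI I (cK I h) (F0k k) (F1k k) (F2k k) (coef_canon_eq_coefF I h) (gL (tK k)) e ∈ W.2)]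
    · rw [Finset.filter_filter]
      exact congrArg Finset.card (Finset.filter_congr fun T _ => and_congr_right fun _ => by
        rw [Nat.cast_mul, Nat.cast_mul, mul_assoc])
  · -- the sublist cap
    rw [hV1, hV2]
    unfold gCapS
    constructor
    · exact (Nat.pow_le_pow_right (by norm_num) (by omega)).trans h2t0
    · exact (Nat.pow_le_pow_right (by norm_num) (by omega)).trans h2t0
  · -- the walk cap
    intro W k' hk'
    rw [hV1, hV2] at hk'
    unfold gCapW
    refine (length_walksU_legsIn_slegsK_le I _ _ W k').trans ?_
    calc gN (plegsK I) * gL (tK k) ^ k' ≤ gN (plegsK I) * gL (tK k) ^ (2 * pT0 (gN (plegsK I))) :=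
          Nat.mul_le_mul_left _ (Nat.pow_le_pow_right (gL_pos _) (by omega))
      _ ≤ (40 * gN (plegsK I)) * (40 * gN (plegsK I)) ^ (4 * tK k) := Nat.mul_le_mul (by omega) hL2t0
      _ = (40 * gN (plegsK I)) ^ (4 * tK k + 1) := by ring

/-- **M4-SEM for the machine's data**: `hatSum = Σ_{T ∈ cyl} Σ_s Σ_{W ∈ bad s T} meet_s(W)`. -/
theorem hatSum_sd2_eq (I : LocalMap k n m) (h : ∀ j, SignDegLE 2 (I.table j)) (hN1 : 1 ≤ gN (plegsK I))
    (st : List ℕ × ℕ) (hst : gExtract (ellK k) (tK k) (plegsK I) = st)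
    (hlab : ∀ lab ∈ st.1, lab ≤ st.2) (kk : ℕ) (T0 : List Bool) :
    ((hatSum (gG (ellK k) (tK k)) kk T0 m
        (allRecs (gCapS (plegsK I)) (gCapW (tK k) (plegsK I)) (plegsK I) st.1 st.2) : ℕ) : ℝ)
      = ∑ T ∈ (univ : Finset (Fin m → Bool)).filter
            (fun T => ∀ i ∈ univ.filter (fun i : Fin m => (i : ℕ) < kk), T i = T0.getD i.val false),
          ∑ s : Fin st.2, ∑ W ∈ badS I h st hlab s T, meetS I h st hlab s W := by
  rw [Finset.sum_comm, hatSum_allRecs_eq, Nat.cast_sum,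
    ← Fin.sum_univ_eq_sum_range (fun s => (((spotRecs (gCapS (plegsK I)) (gCapW (tK k) (plegsK I))
      (slegs (plegsK I) st.1 s)).map fun rec => rec.2.1 * badCount (gG (ellK k) (tK k)) kk T0 m rec).sum : ℝ))]
  exact Finset.sum_congr rfl fun s _ => spot_hat_eq I h hN1 st hst hlab kk T0 s

end Summit.PneNP.PneNP.Theorems.Sd2BlMachine
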